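import Summits.Ventures.DiscreteObjects.UnitDistance.RamifiedReduction
import Summits.Ventures.DiscreteObjects.UnitDistance.FieldPlanes
import Mathlib.NumberTheory.Padics.Hensel

/-!
# The `p`-adic criteria at `p = 7, 11, 19` (and `3`) for real multiquadratic planes, ramified primes included
(cell `pub-namedobj`, target (U), seat udg g11)

Framing (verbatim for the cell): lottery ticket; floor = certified bounds/negative ranges.

For an odd prime `p ≡ 3 (mod 4)` the square classes `ℚ_p^×/ℚ_p^{×2} = ⟨[u₀], [p]⟩` (`u₀` a non-residue; `[−1] = [u₀]`);
the `[−1]`-free subgroups are `{1}` (`K_S ⊂ ℚ_p`), `⟨[p]⟩` (`K_S ⊂ ℚ_p(√p)`) and `⟨[−p]⟩` (`K_S ⊂ ℚ_p(√−p)`).  In the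
vocabulary of `S ⊂ ℕ`: every `d ∈ S` is a quadratic residue unit mod `p`, or `d = p·m` with `m` a residue (frame `+p`),
resp. with `−m` a residue (frame `−p`) — `PadicPattern p S`.  Then (Hensel in `ℤ_p` + `RamifiedReduction` + Madore's
reduction `ValuationRingReduction`) every unit-distance graph with coordinates in `K_S = ℚ(√d : d ∈ S)` is `n`-colourable
whenever `unitCircleGraph (ZMod p)` is: `p = 7 ⇒ χ(K_S²) ≤ 4`, `p = 11, 19 ⇒ χ(K_S²) ≤ 5` (kernel colourings of udg g2/g3).

CENSUS HEADLINE (field form of the cell's FIELD OBSTRUCTION, udg g2 FIELD-OBSTRUCTION.md; in print as the value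
`χ(ℚ(√3,√5,√11)²) = 5` only through Heule's 5-chromatic graphs + reduction mod 11): `colorable_five_plane_heuleField` —
the unit-distance graph of HEULE'S FIELD `ℚ(√3, √5, √11)²` (home of the 510/529/553-vertex 5-chromatic graphs and of Parts'
509) is `5`-colourable in the kernel, so NO 6-chromatic unit-distance graph — no witness of target (U) — has all its
coordinates there; with the Moser spindle `4 ≤ χ ≤ 5`.  Likewise the Exoo–Ismailescu field `ℚ(√3, √11, √247)`.
Nothing here is literature.
-/

noncomputable section

namespace Summit.Ventures.DiscreteObjects.UnitDistance

open Ramified MoserLocal SimpleGraph IntermediateField Polynomial Spectral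
open scoped IntermediateField

section Generic

variable (p : ℕ) [Fact p.Prime]

/-! ## Hensel in `ℤ_p` (odd `p`) -/

/-- `‖2‖ = 1` in `ℤ_p` for odd `p`. -/
theorem PadicOdd.norm_two (hp2 : p ≠ 2) : ‖(2 : ℤ_[p])‖ = 1 := by
  have hle : ‖(2 : ℤ_[p])‖ ≤ 1 := PadicInt.norm_le_one _
  have hlt : ¬ ‖((2 : ℤ) : ℤ_[p])‖ < 1 := by
    rw [PadicInt.norm_int_lt_one_iff_dvd]
    intro h
    have h2 : (p : ℤ) ∣ 2 := h
    have : p ∣ 2 := by exact_mod_cast h2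
    have hp := (Nat.prime_dvd_prime_iff_eq (Fact.out : p.Prime) Nat.prime_two).1 this
    exact hp2 hp
  push_cast at hlt
  exact le_antisymm hle (not_lt.1 hlt)

/-- HENSEL (odd `p`): a `p`-adic unit congruent to a square modulo `p` is a square in `ℚ_p`. -/
theorem PadicOdd.exists_sq_eq (hp2 : p ≠ 2) (u a : ℤ_[p]) (hu : ‖u‖ = 1) (ha : ‖a ^ 2 - u‖ < 1) :
    ∃ r : ℚ_[p], r ^ 2 = (u : ℚ_[p]) := by
  -- `‖a‖ = 1`
  have ha1 : ‖a‖ = 1 := by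
    by_contra hne
    have hlt : ‖a‖ < 1 := lt_of_le_of_ne (PadicInt.norm_le_one a) hne
    have hsq : ‖a ^ 2‖ < 1 := by
      rw [norm_pow]; nlinarith [norm_nonneg a]
    have hne' : ‖a ^ 2‖ ≠ ‖-u‖ := by rw [norm_neg, hu]; exact ne_of_lt hsq
    have := PadicInt.norm_add_eq_max_of_ne hne'
    rw [← sub_eq_add_neg, norm_neg, hu, max_eq_right hsq.le] at this
    rw [this] at ha; exact lt_irrefl _ ha
  set F : Polynomial ℤ_[p] := X ^ 2 - C u with hF
  have hFa : F.aeval a = a ^ 2 - u := by simp [hF]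
  have hF' : (Polynomial.derivative F).aeval a = 2 * a := by
    have hd : Polynomial.derivative F = C (2 : ℤ_[p]) * X := by
      rw [hF, derivative_sub, derivative_X_pow, derivative_C, sub_zero]; simp
    rw [hd]; simp
  have hnorm : ‖F.aeval a‖ < ‖(Polynomial.derivative F).aeval a‖ ^ 2 := by
    rw [hFa, hF', norm_mul, PadicOdd.norm_two p hp2, ha1]; norm_num; exact ha
  obtain ⟨z, hz, -⟩ := hensels_lemma hnorm
  refine ⟨(z : ℚ_[p]), ?_⟩
  have hz' : z ^ 2 = u := by
    have : F.aeval z = z ^ 2 - u := by simp [hF]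
    rw [this] at hz; exact sub_eq_zero.1 hz
  rw [← PadicInt.coe_pow, hz']

/-- QUADRATIC RESIDUES LIFT: if `p ∤ d` and `x² ≡ d (mod p)` then `√d ∈ ℚ_p` (odd `p`). -/
theorem PadicOdd.exists_sq_eq_nat (hp2 : p ≠ 2) (d x : ℕ) (hd : d % p ≠ 0) (hx : (x * x) % p = d % p) :
    ∃ r : ℚ_[p], r ^ 2 = (d : ℚ_[p]) := by
  have hu : ‖((d : ℤ) : ℤ_[p])‖ = 1 := by
    refine le_antisymm (PadicInt.norm_le_one _) (not_lt.1 fun h => hd ?_)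
    rw [PadicInt.norm_int_lt_one_iff_dvd] at h
    have : (p : ℤ) ∣ (d : ℤ) := h
    exact Nat.mod_eq_zero_of_dvd (by exact_mod_cast this)
  have ha : ‖((x : ℤ) : ℤ_[p]) ^ 2 - ((d : ℤ) : ℤ_[p])‖ < 1 := by
    have : ((x : ℤ) : ℤ_[p]) ^ 2 - ((d : ℤ) : ℤ_[p]) = ((x * x - d : ℤ) : ℤ_[p]) := by push_cast; ring
    rw [this, PadicInt.norm_int_lt_one_iff_dvd]
    have h1 : (x * x : ℤ) % p = (d : ℤ) % p := by exact_mod_cast hx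
    exact Int.ModEq.dvd h1.symm
  obtain ⟨r, hr⟩ := PadicOdd.exists_sq_eq p hp2 _ _ hu ha
  exact ⟨r, by rw [hr]; simp⟩

/-! ## The patterns -/

/-- `d` is a nonzero quadratic residue modulo `p`. -/
def IsQR (d : ℕ) : Prop := d % p ≠ 0 ∧ ∃ x ∈ Finset.range p, (x * x) % p = d % p

/-- `−m` is a nonzero quadratic residue modulo `p`. -/
def IsNegQR (m : ℕ) : Prop := m % p ≠ 0 ∧ ∃ x ∈ Finset.range p, (x * x + m) % p = 0

/-- `IsQR` is decidable. -/
instance (d : ℕ) : Decidable (IsQR p d) := by unfold IsQR; infer_instance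
/-- `IsNegQR` is decidable. -/
instance (m : ℕ) : Decidable (IsNegQR p m) := by unfold IsNegQR; infer_instance

/-- The `p`-adic patterns of `S`: all `d ∈ S` have square class in `⟨[p]⟩` (frame `+p`) or all in `⟨[−p]⟩` (frame `−p`). -/
def PadicPattern (S : Finset ℕ) : Prop :=
  (∀ d ∈ S, IsQR p d ∨ (d % p = 0 ∧ IsQR p (d / p))) ∨ (∀ d ∈ S, IsQR p d ∨ (d % p = 0 ∧ IsNegQR p (d / p)))

/-- The `p`-adic patterns are decidable (`decide` for concrete `p`, `S`). -/
instance (S : Finset ℕ) : Decidable (PadicPattern p S) := by unfold PadicPattern; infer_instance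

/-- Residues give square roots in `ℚ_p ⊂ L`. -/
theorem exists_sq_eq_of_isQR (hp2 : p ≠ 2) (F : Ramified.Frame p) {d : ℕ} (h : IsQR p d) :
    ∃ w ∈ F.L, w ^ 2 = (d : Ω p) := by
  obtain ⟨hd, x, -, hx⟩ := h
  obtain ⟨r, hr⟩ := PadicOdd.exists_sq_eq_nat p hp2 d x hd hx
  exact ⟨algebraMap ℚ_[p] (Ω p) r, IntermediateField.algebraMap_mem _ _, by rw [← map_pow, hr, map_natCast]⟩

/-- Frame `+p`: `d = p·m` with `m` a residue ⇒ `√d = √m · g ∈ ℚ_p(g)`, `g² = p`. -/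
theorem exists_sq_eq_framePos (hp2 : p ≠ 2) {d : ℕ} (h : IsQR p d ∨ (d % p = 0 ∧ IsQR p (d / p))) :
    ∃ w ∈ (framePos p).L, w ^ 2 = (d : Ω p) := by
  rcases h with h | ⟨hd0, hm⟩
  · exact exists_sq_eq_of_isQR p hp2 _ h
  · obtain ⟨hm0, x, -, hx⟩ := hm
    obtain ⟨r, hr⟩ := PadicOdd.exists_sq_eq_nat p hp2 (d / p) x hm0 hx
    refine ⟨algebraMap ℚ_[p] (Ω p) r * (framePos p).g,
      mul_mem (IntermediateField.algebraMap_mem _ _) (mem_adjoin_simple_self _ _), ?_⟩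
    have hd : (d : Ω p) = (p : Ω p) * ((d / p : ℕ) : Ω p) := by
      have : d = p * (d / p) := (Nat.mul_div_cancel' (Nat.dvd_of_mod_eq_zero hd0)).symm
      conv_lhs => rw [this]
      push_cast; ring
    rw [mul_pow, ← map_pow, hr, map_natCast, framePos_g_sq, hd]; ring

/-- Frame `−p`: `d = p·m` with `−m` a residue ⇒ `√d = √(−m) · g ∈ ℚ_p(g)`, `g² = −p`. -/
theorem exists_sq_eq_frameNeg (hp2 : p ≠ 2) {d : ℕ} (h : IsQR p d ∨ (d % p = 0 ∧ IsNegQR p (d / p))) :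
    ∃ w ∈ (frameNeg p).L, w ^ 2 = (d : Ω p) := by
  rcases h with h | ⟨hd0, hm⟩
  · exact exists_sq_eq_of_isQR p hp2 _ h
  · obtain ⟨hm0, x, -, hx⟩ := hm
    -- `−m` is a unit square mod p: lift `x² ≡ −m`
    set m := d / p with hm_def
    have hu : ‖((-(m : ℤ)) : ℤ_[p])‖ = 1 := by
      rw [norm_neg]
      refine le_antisymm (PadicInt.norm_le_one _) (not_lt.1 fun h => hm0 ?_)
      rw [PadicInt.norm_int_lt_one_iff_dvd] at h
      have : (p : ℤ) ∣ (m : ℤ) := h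
      exact Nat.mod_eq_zero_of_dvd (by exact_mod_cast this)
    have ha : ‖((x : ℤ) : ℤ_[p]) ^ 2 - ((-(m : ℤ)) : ℤ_[p])‖ < 1 := by
      have : ((x : ℤ) : ℤ_[p]) ^ 2 - ((-(m : ℤ)) : ℤ_[p]) = ((x * x + m : ℤ) : ℤ_[p]) := by push_cast; ring
      rw [this, PadicInt.norm_int_lt_one_iff_dvd]
      have h1 : ((x * x + m : ℕ) : ℤ) % p = 0 := by exact_mod_cast hx
      push_cast at h1
      exact Int.dvd_of_emod_eq_zero h1
    obtain ⟨r, hr⟩ := PadicOdd.exists_sq_eq p hp2 _ _ hu ha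
    refine ⟨algebraMap ℚ_[p] (Ω p) r * (frameNeg p).g,
      mul_mem (IntermediateField.algebraMap_mem _ _) (mem_adjoin_simple_self _ _), ?_⟩
    have hd : (d : Ω p) = (p : Ω p) * (m : Ω p) := by
      have : d = p * m := (Nat.mul_div_cancel' (Nat.dvd_of_mod_eq_zero hd0)).symm
      conv_lhs => rw [this]
      push_cast; ring
    have hr' : (algebraMap ℚ_[p] (Ω p) r) ^ 2 = -(m : Ω p) := by
      rw [← map_pow, hr]; simp
    rw [mul_pow, hr', frameNeg_g_sq, hd]; ring

/-! ## The criterion -/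

/-- A (fixed, arbitrary) `ℚ`-embedding `ℚ(√d : d ∈ S) → Ω = \overline{ℚ_p}`. -/
def multiSqrtEmbedP (S : Finset ℕ) : multiSqrtField S →ₐ[ℚ] Ω p := IsAlgClosed.lift

/-- Colouring through a ramified frame of `ℚ_p`: if every `√d`, `d ∈ S`, lies in `L = ℚ_p(g)` and `unitCircleGraph (ZMod p)`
is `n`-colourable (`p ≡ 3 mod 4`), every graph with `ℚ(√d : d ∈ S)`-coordinates and unit-quadrance edges is `n`-colourable. -/
theorem colorable_of_padicFrame (F : Ramified.Frame p) (h4 : p % 4 = 3) {n : ℕ}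
    (hZ : (unitCircleGraph (ZMod p)).Colorable n) (S : Finset ℕ) (hroots : ∀ d ∈ S, ∃ w ∈ F.L, w ^ 2 = (d : Ω p))
    {V : Type*} {G : SimpleGraph V} (x y : V → multiSqrtField S)
    (hadj : ∀ ⦃v w : V⦄, G.Adj v w → (x v - x w) ^ 2 + (y v - y w) ^ 2 = 1) : G.Colorable n := by
  have hmem : ∀ t, (multiSqrtEmbedP p S).toRingHom t ∈ F.L :=
    fun t => multiSqrtEmbed_mem_of_roots S (multiSqrtEmbedP p S) F.L hroots t
  set ψ : multiSqrtField S →+* F.L := (multiSqrtEmbedP p S).toRingHom.codRestrict F.L hmem with hψ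
  refine F.colorable h4 hZ (fun v => ψ (x v)) (fun v => ψ (y v)) ?_
  intro v w hvw
  have := congrArg ψ (hadj hvw)
  simpa [map_add, map_sub, map_pow] using this

/-- THE `p`-ADIC CRITERION (kernel; `p ≡ 3 mod 4`): if `S` fits a `p`-adic pattern and `unitCircleGraph (ZMod p)` is
`n`-colourable, every graph with `ℚ(√d : d ∈ S)`-coordinates and unit-quadrance edges is `n`-colourable. -/
theorem colorable_of_padicPattern (h4 : p % 4 = 3) {n : ℕ} (hZ : (unitCircleGraph (ZMod p)).Colorable n)
    (S : Finset ℕ) (hS : PadicPattern p S) {V : Type*} {G : SimpleGraph V} (x y : V → multiSqrtField S)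
    (hadj : ∀ ⦃v w : V⦄, G.Adj v w → (x v - x w) ^ 2 + (y v - y w) ^ 2 = 1) : G.Colorable n := by
  have hp2 : p ≠ 2 := by intro h; rw [h] at h4; norm_num at h4
  rcases hS with h | h
  · exact colorable_of_padicFrame p (framePos p) h4 hZ S (fun d hd => exists_sq_eq_framePos p hp2 (h d hd)) x y hadj
  · exact colorable_of_padicFrame p (frameNeg p) h4 hZ S (fun d hd => exists_sq_eq_frameNeg p hp2 (h d hd)) x y hadj

/-- Plane form of the `p`-adic criterion. -/
theorem colorable_plane_of_padicPattern (h4 : p % 4 = 3) {n : ℕ} (hZ : (unitCircleGraph (ZMod p)).Colorable n)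
    (S : Finset ℕ) (hS : PadicPattern p S) :
    (planeUnitDistanceGraph.induce (fieldPoints (multiSqrtField S))).Colorable n := by
  refine colorable_of_padicPattern p h4 hZ S hS (G := planeUnitDistanceGraph.induce (fieldPoints (multiSqrtField S)))
    (fun q => ⟨(q : EuclideanSpace ℝ (Fin 2)) 0, q.2 0⟩) (fun q => ⟨(q : EuclideanSpace ℝ (Fin 2)) 1, q.2 1⟩) ?_
  intro v w hvw
  apply Subtype.ext
  push_cast
  exact sq_add_sq_eq_one_of_dist_eq_one hvw

/-- Realisation form of the `p`-adic criterion (census: a unit-distance graph needing more than `n` colours leaves `K_S`). -/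
theorem colorable_of_realisation_padicPattern (h4 : p % 4 = 3) {n : ℕ} (hZ : (unitCircleGraph (ZMod p)).Colorable n)
    (S : Finset ℕ) (hS : PadicPattern p S) {V : Type*} {G : SimpleGraph V} {q : V → EuclideanSpace ℝ (Fin 2)}
    (hq : IsUnitDistanceRealisation G q) (hK : ∀ v i, q v i ∈ multiSqrtField S) : G.Colorable n := by
  refine colorable_of_padicPattern p h4 hZ S hS (G := G) (fun v => ⟨q v 0, hK v 0⟩) (fun v => ⟨q v 1, hK v 1⟩) ?_
  intro v w hvw
  apply Subtype.ext
  push_cast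
  exact sq_add_sq_eq_one_of_dist_eq_one (hq.2 hvw)

end Generic

/-! ## The three killer primes `7, 11, 19` (and `3`) -/

/-- `p = 7`: `χ(K_S²) ≤ 4` for every `S` in a `7`-adic pattern (e.g. `ℚ(√2, √7)`, `ℚ(√2, √7, √11)`, `ℚ(√2, √21)`). -/
theorem colorable_four_plane_of_sevenAdic (S : Finset ℕ) (hS : PadicPattern 7 S) :
    (planeUnitDistanceGraph.induce (fieldPoints (multiSqrtField S))).Colorable 4 :=
  colorable_plane_of_padicPattern 7 (by norm_num) unitCircleGraph_zmod7_colorable_four S hS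

/-- `p = 11`: `χ(K_S²) ≤ 5` for every `S` in an `11`-adic pattern. -/
theorem colorable_five_plane_of_elevenAdic (S : Finset ℕ) (hS : PadicPattern 11 S) :
    (planeUnitDistanceGraph.induce (fieldPoints (multiSqrtField S))).Colorable 5 :=
  colorable_plane_of_padicPattern 11 (by norm_num) unitCircleGraph_zmod11_colorable_five S hS

/-- `p = 19`: `χ(K_S²) ≤ 5` for every `S` in a `19`-adic pattern. -/
theorem colorable_five_plane_of_nineteenAdic (S : Finset ℕ) (hS : PadicPattern 19 S) :
    (planeUnitDistanceGraph.induce (fieldPoints (multiSqrtField S))).Colorable 5 :=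
  colorable_plane_of_padicPattern 19 (by norm_num) unitCircleGraph_zmod19_colorable_five S hS

/-- `p = 3` through the generic machinery (cf. `ThreeAdicCriterion`): `χ(K_S²) ≤ 3`. -/
theorem colorable_three_plane_of_threeAdic' (S : Finset ℕ) (hS : PadicPattern 3 S) :
    (planeUnitDistanceGraph.induce (fieldPoints (multiSqrtField S))).Colorable 3 :=
  colorable_plane_of_padicPattern 3 (by norm_num) unitCircleGraph_zmod3_colorable_three S hS

/-! ## Census headlines: Heule's field and the Exoo–Ismailescu field -/

/-- HEULE'S FIELD IS 5-COLOURABLE (kernel): the unit-distance graph of `ℚ(√3, √5, √11)²` — containing Heule's 553/529/510-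
and Parts' 509-vertex 5-chromatic graphs — is `5`-colourable (`3, 5` are residues mod `11`; `11 = 11·1`), so no 6-chromatic
unit-distance graph has all its coordinates in `ℚ(√3, √5, √11)`.  (The cell's FIELD OBSTRUCTION, udg g2, field form.) -/
theorem colorable_five_plane_heuleField :
    (planeUnitDistanceGraph.induce (fieldPoints (multiSqrtField {3, 5, 11}))).Colorable 5 :=
  colorable_five_plane_of_elevenAdic _ (by decide)

/-- …and it needs at least `4` colours (the Moser spindle lies in `ℚ(√3, √11)² ⊂ ℚ(√3, √5, √11)²`); in print `χ = 5`
(Heule 2018, by the 5-chromatic graphs themselves — a SAT certificate, not in the kernel). -/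
theorem not_colorable_three_plane_heuleField :
    ¬ (planeUnitDistanceGraph.induce (fieldPoints (multiSqrtField {3, 5, 11}))).Colorable 3 :=
  not_colorable_three_plane_of_moser _ (by simpa using sqrt_mem_multiSqrtField (S := {3, 5, 11}) (d := 3) (by decide))
    (by simpa using sqrt_mem_multiSqrtField (S := {3, 5, 11}) (d := 11) (by decide))

/-- A 6-chromatic witness of target (U) must use a coordinate OUTSIDE Heule's field `ℚ(√3, √5, √11)`. -/
theorem sixChromatic_witness_leaves_heuleField {V : Type*} {G : SimpleGraph V} {q : V → EuclideanSpace ℝ (Fin 2)}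
    (hq : IsUnitDistanceRealisation G q) (h5 : ¬ G.Colorable 5) : ∃ v i, q v i ∉ multiSqrtField {3, 5, 11} := by
  by_contra hall
  push Not at hall
  exact h5 (colorable_of_realisation_padicPattern 11 (by norm_num) unitCircleGraph_zmod11_colorable_five _ (by decide)
    hq hall)

/-- THE EXOO–ISMAILESCU FIELD `ℚ(√3, √11, √247)` (`247 ≡ 5 mod 11`, a residue) is `5`-colourable as well. -/
theorem colorable_five_plane_exooIsmailescuField :
    (planeUnitDistanceGraph.induce (fieldPoints (multiSqrtField {3, 11, 247}))).Colorable 5 :=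
  colorable_five_plane_of_elevenAdic _ (by decide)

/-- `7`-adic examples: `χ(ℚ(√2, √7, √11)²) ≤ 4` (`2 ≡ 3²`, `11 ≡ 2²` mod `7`; `7 = 7·1`) and `χ(ℚ(√2, √21, √35)²) ≤ 4`
(frame `−7`: `21 = 7·3`, `35 = 7·5`, `−3 ≡ 2²`, `−5 ≡ 3²` mod `7`). -/
theorem colorable_four_plane_sevenAdic_examples :
    (planeUnitDistanceGraph.induce (fieldPoints (multiSqrtField {2, 7, 11}))).Colorable 4 ∧
      (planeUnitDistanceGraph.induce (fieldPoints (multiSqrtField {2, 21, 35}))).Colorable 4 :=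
  ⟨colorable_four_plane_of_sevenAdic _ (by decide), colorable_four_plane_of_sevenAdic _ (by decide)⟩

end Summit.Ventures.DiscreteObjects.UnitDistance
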